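import Literature.AlgebraicGeometry.Motives.TateTheoremKunnethFullyAlgebraicFactor
import Literature.AlgebraicGeometry.Motives.StandardConjectureDKunnethFullyAlgebraicFactor
import HarnessLib

/-!
# Numerically trivial classes and numerical ranks along a factor with fully algebraic cohomology:
# `N^c(X × Z)_K = ⊕_{p+q=c} N^p(X)_K ⊗ H^{2q}(Z)`, `dim N^c(X × Z) = Σ dim N^p(X)·b_{2q}(Z)`,
# `ρ_c(X × Z) = Σ_{p+q=c} ρ_p(X)·b_{2q}(Z)`

Topic `Literature/AlgebraicGeometry/Motives`; THEOREMS ONLY (no definition, no instance, no named fact;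
D-0026).

For `X` smooth projective of dimension `n` over a field `k`, a Weil cohomology `W` with coefficients `K ⊇ ℚ`
and `p + p′ = n`, the **numerically trivial `K`-classes** in codimension `p` are the left kernel of the
Poincaré pairing restricted to algebraic classes, `N^p(X) = {x ∈ K·Aᵖ(X) | ⟨x, K·A^{p′}(X)⟩ = 0}`; the
**numerical rank** `ρ_p(X)` is the rank of `K·Aᵖ(X) × K·A^{p′}(X) → K`, the number in the tree's form of
Tate's «order of the pole = rank» (`hasPoleOfOrderAt_zetaSeries_rank_iff'`), and `ρ_p(X) + dim N^p(X) =
dim K·Aᵖ(X)`.  No definition is introduced: `N^p(X)` is written inline as the submodule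
`K·Aᵖ(X) ⊓ ⨅_{p′, 2p+2p′=2n} Ker(x ↦ ⟨x, −⟩|_{K·A^{p′}(X)})` of `H^{2p}(X)` (the inner infimum has the single
index `p′ = n − p`, `mem_numTrivialClasses_iff_of_add_eq`), and `ρ` as `finrank (range (cupPairing.domRestrict₁₂ …))`.

For a factor `Z` (dimension `m`) with fully algebraic cohomology — `K·A^q(Z) = H^{2q}(Z)` for all `q`,
`b_{odd}(Z) = 0` — rows g53-#1 ∕ #4 ∕ #7 gave `K·Aᶜ(X × Z) = ⊕ K·Aᵖ(X) ⊗ H^{2q}(Z)`, its dimension, and the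
transport of hom = num.  Here, the numerical side (Kahn's (6.4.1) `A_∼(X × 𝐏¹) = A_∼(X) ⊕ A_∼(X)` for
`∼ = num`, along a general fully algebraic factor):

* §1 (`X` alone) membership in `N^p(X)` (`mem_numTrivialClasses_iff`, `…_of_add_eq`), `N^p(X)` is the image of
  `Ker(K·Aᵖ(X) → Hom(K·A^{p′}(X), K))` (`map_subtype_ker_cupPairing_domRestrict₁₂`), hence
  **`ρ_p(X) + dim N^p(X) = dim K·Aᵖ(X)`** (`finrank_range_add_finrank_numTrivialClasses`), and
  `N^p(X) = 0 ⟺ Eᵖ(X)` (hom = num in codimension `p`, `numTrivialClasses_eq_bot_iff`).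
* §2 **`z ∈ N^c(X × Z)` iff every Künneth component `z_{2p,2q}` lies in `N^p(X) ⊗ H^{2q}(Z)`**
  (`mem_numTrivialClasses_tensor_iff`): the contractions of `z_{2p,2q}` are the transfers
  `pr_{X*}(z ∪ pr_Z^* b′) ∈ K·Aᵖ(X)` (row g53-#1) and `⟨pr_{X*}(z ∪ pr_Z^* b′), x′⟩_X = ⟨z, x′ × b′⟩_{X×Z}`
  (row g53-#7's adjunction identity), while `K·A^{c′}(X × Z)` is spanned by the `x′ × b′`.
* §3 **`dim N^c(X × Z) = Σ_{p+q=c} dim N^p(X)·b_{2q}(Z)`** (`finrank_numTrivialClasses_tensor`) and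
  **`ρ_c(X × Z) = Σ_{p+q=c} ρ_p(X)·b_{2q}(Z)`** in the forms `ρ_c(X × Z) + Σ dim N^p(X)·b_{2q}(Z) =
  Σ dim K·Aᵖ(X)·b_{2q}(Z)` (`finrank_range_cupPairing_tensor_add`) and
  `ρ_c(X × Z) = Σ (dim K·Aᵖ(X) − dim N^p(X))·b_{2q}(Z)` (`finrank_range_cupPairing_tensor`); under hom = num
  on `X`, `ρ_c(X × Z) = dim K·Aᶜ(X × Z)` (`finrank_range_cupPairing_tensor_of_forall_eq_bot`).

HC is not touched.

## References

* [Kleiman1968AlgebraicCycles] S. Kleiman, *Algebraic cycles and the Weil conjectures* (1968), §1.2 (A)–(B),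
  §3 (numerical equivalence, `D(X)`).
* [Kahn2020] B. Kahn, *Zeta and L-Functions of Varieties and Motives* (2020), §3.5.1 (`f_*` adjoint to `f^*`),
  §6.4 Prop. 6.11 (6.4.1)–Prop. 6.12 (`A_∼(X × 𝐏¹)` for every adequate `∼`), §6.12.2.
* [Fulton1998] W. Fulton, *Intersection Theory* (1998), Ex. 1.10.2, Th. 3.3 (b).
* [Roman2008] S. Roman, *Advanced Linear Algebra* (2008), Ch. 14 Th. 14.5–14.6.
* [TateWoodsHole1965] J. Tate, *Algebraic cycles and poles of zeta functions* (1965), §3 (12) (the rank `ρ`).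
* Tree: rows g53-#1 (`pushforward_fst_cup_snd_eq_rid_lTensor_kunnethComponent`,
  `pushforward_fst_cup_snd_mem_algebraicClasses`, `mem_algebraicClasses_tensor_iff`, `algebraicClasses_tensor_eq_iSup`,
  `map₂_externalCup_algebraicClasses_top_le`), g53-#4 (`finrank_eq_sum_of_kunneth_pieces`,
  `finrank_algebraicClasses_tensor`), g53-#6 (`map_kunnethComponent_eq_of_mem_iff`), g53-#7
  (`cupPairing_right_externalCup`).

## Provenance

Lane `lit-hodgefound` (summit `HodgeConjecture`, Track 2 foundations library, Layer B: motives — numerical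
equivalence on products), seat `lit-hodgefound-p29` (literature-prover, generation 53, row g53-#9).
-/

universe u v

open CategoryTheory AlgebraicGeometry MonoidalCategory CartesianMonoidalCategory
open scoped TensorProduct
open Finset.HasAntidiagonal (antidiagonal mem_antidiagonal)

namespace Literature.AlgebraicGeometry.Motives

namespace WeilCohomology

open Literature.LinearAlgebra.TensorContraction

variable {k : Type u} [Field k] {K : Type v} [Field K] [CharZero K] (W : WeilCohomology k K)
variable {n m : ℕ} {X Z : SchemeOver k}

/-! ### §1 Numerically trivial `K`-classes and the numerical rank on `X` -/

/-- Membership in the inline submodule of **numerically trivial `K`-classes**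
`N^p(X) = K·Aᵖ(X) ⊓ ⨅_{p′, 2p+2p′=2n} Ker ⟨−, K·A^{p′}(X)⟩`: `x ∈ K·Aᵖ(X)` and `⟨x, x′⟩ = 0` for every algebraic
`x′` of complementary codimension. [cite: Kleiman1968AlgebraicCycles, §3] -/
theorem mem_numTrivialClasses_iff {p : ℕ} (x : W.obj X (2 * p)) :
    x ∈ W.algebraicClasses X p ⊓ ⨅ (p' : ℕ), ⨅ (hp : 2 * p + 2 * p' = 2 * n),
        LinearMap.ker ((W.cupPairing X n (2 * p) (2 * p') hp).domRestrict₂ (W.algebraicClasses X p')) ↔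
      x ∈ W.algebraicClasses X p ∧ ∀ (p' : ℕ) (hp : 2 * p + 2 * p' = 2 * n),
        ∀ x' ∈ W.algebraicClasses X p', W.cupPairing X n (2 * p) (2 * p') hp x x' = 0 := by
  simp only [Submodule.mem_inf, Submodule.mem_iInf, LinearMap.mem_ker, LinearMap.ext_iff,
    LinearMap.domRestrict₂_apply, LinearMap.zero_apply, Subtype.forall]

/-- With `p + p′ = n` the infimum has the single index `p′`: `x ∈ N^p(X)` iff `x ∈ K·Aᵖ(X)` and
`⟨x, K·A^{p′}(X)⟩ = 0`. [cite: Kleiman1968AlgebraicCycles, §3] -/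
theorem mem_numTrivialClasses_iff_of_add_eq {p p' : ℕ} (hpp' : p + p' = n) (hp : 2 * p + 2 * p' = 2 * n)
    (x : W.obj X (2 * p)) :
    x ∈ W.algebraicClasses X p ⊓ ⨅ (p' : ℕ), ⨅ (hp : 2 * p + 2 * p' = 2 * n),
        LinearMap.ker ((W.cupPairing X n (2 * p) (2 * p') hp).domRestrict₂ (W.algebraicClasses X p')) ↔
      x ∈ W.algebraicClasses X p ∧
        ∀ x' ∈ W.algebraicClasses X p', W.cupPairing X n (2 * p) (2 * p') hp x x' = 0 := by
  rw [W.mem_numTrivialClasses_iff]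
  refine and_congr_right fun _ ↦ ⟨fun h ↦ h p' hp, fun h p'' hp'' ↦ ?_⟩
  obtain rfl : p'' = p' := by omega
  exact h

/-- **`N^p(X)` is the kernel of `K·Aᵖ(X) → Hom_K(K·A^{p′}(X), K)`** (the restricted Poincaré pairing), viewed
in `H^{2p}(X)`. [cite: Kleiman1968AlgebraicCycles, §3] -/
theorem map_subtype_ker_cupPairing_domRestrict₁₂ {p p' : ℕ} (hpp' : p + p' = n)
    (hp : 2 * p + 2 * p' = 2 * n) :
    (LinearMap.ker ((W.cupPairing X n (2 * p) (2 * p') hp).domRestrict₁₂ (W.algebraicClasses X p)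
        (W.algebraicClasses X p'))).map (W.algebraicClasses X p).subtype =
      W.algebraicClasses X p ⊓ ⨅ (p' : ℕ), ⨅ (hp : 2 * p + 2 * p' = 2 * n),
        LinearMap.ker ((W.cupPairing X n (2 * p) (2 * p') hp).domRestrict₂ (W.algebraicClasses X p')) := by
  ext x
  rw [W.mem_numTrivialClasses_iff_of_add_eq hpp' hp, Submodule.mem_map]
  constructor
  · rintro ⟨y, hy, rfl⟩
    refine ⟨y.2, fun x' hx' ↦ ?_⟩
    have h0 := LinearMap.congr_fun (LinearMap.mem_ker.mp hy) ⟨x', hx'⟩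
    rwa [LinearMap.domRestrict₁₂_apply, LinearMap.zero_apply] at h0
  · rintro ⟨hx, h⟩
    refine ⟨⟨x, hx⟩, LinearMap.mem_ker.mpr (LinearMap.ext fun x' ↦ ?_), rfl⟩
    rw [LinearMap.domRestrict₁₂_apply, LinearMap.zero_apply]
    exact h x' x'.2

/-- **`ρ_p(X) + dim N^p(X) = dim K·Aᵖ(X)`** (`p + p′ = n`): the numerical rank — the rank of
`K·Aᵖ(X) × K·A^{p′}(X) → K` — and the dimension of the numerically trivial classes add up to `dim K·Aᵖ(X)`
(rank–nullity). [cite: Kleiman1968AlgebraicCycles, §3] [cite: TateWoodsHole1965, §3 (12)] -/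
theorem finrank_range_add_finrank_numTrivialClasses (hX : IsSmoothProjective n X) {p p' : ℕ}
    (hpp' : p + p' = n) (hp : 2 * p + 2 * p' = 2 * n) :
    Module.finrank K (LinearMap.range ((W.cupPairing X n (2 * p) (2 * p') hp).domRestrict₁₂
        (W.algebraicClasses X p) (W.algebraicClasses X p'))) +
      Module.finrank K ↥(W.algebraicClasses X p ⊓ ⨅ (p' : ℕ), ⨅ (hp : 2 * p + 2 * p' = 2 * n),
        LinearMap.ker ((W.cupPairing X n (2 * p) (2 * p') hp).domRestrict₂ (W.algebraicClasses X p'))) =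
      Module.finrank K (W.algebraicClasses X p) := by
  haveI := W.finite_obj hX (2 * p)
  rw [← W.map_subtype_ker_cupPairing_domRestrict₁₂ hpp' hp, Submodule.finrank_map_subtype_eq]
  exact LinearMap.finrank_range_add_finrank_ker _

/-- **`ρ_p(X) = dim K·Aᵖ(X) − dim N^p(X)`** (`p + p′ = n`). [cite: Kleiman1968AlgebraicCycles, §3] [cite: TateWoodsHole1965, §3 (12)] -/
theorem finrank_range_cupPairing_eq_sub (hX : IsSmoothProjective n X) {p p' : ℕ} (hpp' : p + p' = n)
    (hp : 2 * p + 2 * p' = 2 * n) :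
    Module.finrank K (LinearMap.range ((W.cupPairing X n (2 * p) (2 * p') hp).domRestrict₁₂
        (W.algebraicClasses X p) (W.algebraicClasses X p'))) =
      Module.finrank K (W.algebraicClasses X p) -
        Module.finrank K ↥(W.algebraicClasses X p ⊓ ⨅ (p' : ℕ), ⨅ (hp : 2 * p + 2 * p' = 2 * n),
          LinearMap.ker ((W.cupPairing X n (2 * p) (2 * p') hp).domRestrict₂ (W.algebraicClasses X p'))) :=
  Nat.eq_sub_of_add_eq (W.finrank_range_add_finrank_numTrivialClasses hX hpp' hp)

/-- **`N^p(X) = 0 ⟺ Eᵖ(X)`**: no numerically trivial classes iff the pairing `K·Aᵖ(X) × K·A^{p′}(X) → K` has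
trivial left kernel (hom = num in codimension `p`; `p + p′ = n`). [cite: Kleiman1968AlgebraicCycles, §3 D(X)] -/
theorem numTrivialClasses_eq_bot_iff {p p' : ℕ} (hpp' : p + p' = n) (hp : 2 * p + 2 * p' = 2 * n) :
    W.algebraicClasses X p ⊓ (⨅ (p' : ℕ), ⨅ (hp : 2 * p + 2 * p' = 2 * n),
        LinearMap.ker ((W.cupPairing X n (2 * p) (2 * p') hp).domRestrict₂ (W.algebraicClasses X p'))) = ⊥ ↔
      ∀ x ∈ W.algebraicClasses X p, (∀ x' ∈ W.algebraicClasses X p',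
        W.cupPairing X n (2 * p) (2 * p') hp x x' = 0) → x = 0 := by
  rw [Submodule.eq_bot_iff]
  refine ⟨fun h x hx hperp ↦ h x ((W.mem_numTrivialClasses_iff_of_add_eq hpp' hp x).mpr ⟨hx, hperp⟩),
    fun h x hx ↦ ?_⟩
  obtain ⟨hxA, hperp⟩ := (W.mem_numTrivialClasses_iff_of_add_eq hpp' hp x).mp hx
  exact h x hxA hperp

/-! ### §2 `z ∈ N^c(X × Z)` iff every Künneth component lies in `N^p(X) ⊗ H^{2q}(Z)` -/

/-- **`z ∈ N^c(X × Z)` iff `z_{2p,2q} ∈ N^p(X) ⊗ H^{2q}(Z)` for all `p + q = c`**, for `Z` with `K·A^q(Z) =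
H^{2q}(Z)` for all `q` and `b_{odd}(Z) = 0`.  (`⟹`) the contraction of `z_{2p,2q}` against `tr_Z(− ∪ b′)` is
`pr_{X*}(z ∪ pr_Z^* b′) ∈ K·Aᵖ(X)`, and `⟨pr_{X*}(z ∪ pr_Z^* b′), x′⟩_X = ⟨z, x′ × b′⟩ = 0` since `x′ × b′` is
algebraic; (`⟸`) `z` is algebraic (row g53-#1) and `K·A^{c′}(X × Z)` is spanned by the `x′ × b′`, on which
`⟨z, −⟩` is a pairing of a contraction of `z_{2p,2q} ∈ N^p(X) ⊗ H^{2q}(Z)` with `x′ ∈ K·A^{p′}(X)`, i.e. `0`.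
This is `A_num(X × Z) = ⊕ A_num(X) ⊗ H(Z)` (Kahn (6.4.1) for `∼ = num`, `Z = 𝐏¹`).
[cite: Kahn2020, §6.4 Prop. 6.11 (6.4.1)–Prop. 6.12 and §3.5.1] [cite: Kleiman1968AlgebraicCycles, §3 and §1.2 (A)–(B)]
[cite: Roman2008, Ch. 14 Th. 14.5] -/
theorem mem_numTrivialClasses_tensor_iff (hX : IsSmoothProjective n X) (hZ : IsSmoothProjective m Z)
    (hZalg : ∀ q, W.algebraicClasses Z q = ⊤) (hZodd : ∀ j, Odd j → Module.finrank K (W.obj Z j) = 0)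
    {c : ℕ} (z : W.obj (X ⊗ Z) (2 * c)) :
    z ∈ W.algebraicClasses (X ⊗ Z) c ⊓ ⨅ (c' : ℕ), ⨅ (hc : 2 * c + 2 * c' = 2 * (n + m)),
        LinearMap.ker ((W.cupPairing (X ⊗ Z) (n + m) (2 * c) (2 * c') hc).domRestrict₂
          (W.algebraicClasses (X ⊗ Z) c')) ↔
      ∀ (p q : ℕ) (h : 2 * p + 2 * q = 2 * c), W.kunnethComponent hX hZ (2 * p) (2 * q) h z ∈
        Submodule.map₂ (TensorProduct.mk K (W.obj X (2 * p)) (W.obj Z (2 * q)))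
          (W.algebraicClasses X p ⊓ ⨅ (p' : ℕ), ⨅ (hp : 2 * p + 2 * p' = 2 * n),
            LinearMap.ker ((W.cupPairing X n (2 * p) (2 * p') hp).domRestrict₂ (W.algebraicClasses X p'))) ⊤ := by
  have hXZ := IsSmoothProjective.tensor_holds hX hZ
  constructor
  · intro hz p q h
    obtain ⟨hzA, hzN⟩ := (W.mem_numTrivialClasses_iff z).mp hz
    by_cases hqm : m < q
    · exact W.kunnethComponent_mem_map₂_of_lt hX hZ (by omega) h _ z
    by_cases hpn : n < p
    · haveI := W.subsingleton_obj hX (i := 2 * p) (by omega)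
      rw [eq_zero_of_subsingleton_left (W.kunnethComponent hX hZ (2 * p) (2 * q) h z)]
      exact Submodule.zero_mem _
    haveI := W.finite_obj hZ (2 * q)
    have hh : 2 * q + 2 * (m - q) = 2 * m := by omega
    haveI := W.isPerfPair_cupPairing hZ (2 * q) (2 * (m - q)) hh
    refine mem_map₂_top_of_forall_rid_lTensor_mem _ fun φ ↦ ?_
    obtain ⟨b', rfl⟩ :=
      (LinearMap.IsPerfPair.bijective_right (W.cupPairing Z m (2 * q) (2 * (m - q)) hh)).2 φ
    rw [← W.pushforward_fst_cup_snd_eq_rid_lTensor_kunnethComponent hX hZ h hh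
      (s := 2 * (c + (m - q))) (by omega) (d' := 2 * (n - p)) (by omega) (by omega) z b',
      W.mem_numTrivialClasses_iff_of_add_eq (show p + (n - p) = n by omega) (by omega)]
    refine ⟨W.pushforward_fst_cup_snd_mem_algebraicClasses hX hZ (r := c + (m - q)) rfl (by omega)
      (by omega) (by omega) hzA (by rw [hZalg]; exact Submodule.mem_top), fun x' hx' ↦ ?_⟩
    -- `⟨pr_{X*}(z ∪ pr_Z^* b′), x′⟩_X = ⟨z, x′ × b′⟩_{X×Z} = 0`
    rw [← W.cupPairing_right_externalCup hX hZ (show 2 * (n - p) + 2 * (m - q) = 2 * (n + m - c) by omega)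
      (show 2 * c + 2 * (n + m - c) = 2 * (n + m) by omega) _ _ _ (Or.inl ⟨n - p, two_mul _⟩) z x' b']
    exact hzN (n + m - c) (by omega) _ (W.map₂_externalCup_algebraicClasses_top_le hX hZ (by omega)
      (hZalg (m - q)) _ (Submodule.apply_mem_map₂ _ hx' Submodule.mem_top))
  · intro hz
    rw [W.mem_numTrivialClasses_iff]
    refine ⟨(W.mem_algebraicClasses_tensor_iff hX hZ hZalg hZodd z).mpr fun p q h ↦
      Submodule.map₂_le_map₂_left inf_le_left (hz p q h), fun c' hc a' ha' ↦ ?_⟩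
    -- `⟨z, −⟩` kills `K·A^{c′}(X × Z) = Σ K·A^{p′}(X) × H^{2q′}(Z)`
    suffices hle : W.algebraicClasses (X ⊗ Z) c' ≤
        LinearMap.ker (W.cupPairing (X ⊗ Z) (n + m) (2 * c) (2 * c') hc z) from LinearMap.mem_ker.mp (hle ha')
    rw [W.algebraicClasses_tensor_eq_iSup hX hZ hZalg hZodd c']
    refine iSup_le fun p' ↦ iSup_le fun q' ↦ iSup_le fun h' ↦ Submodule.map₂_le.mpr fun x' hx' b' _ ↦ ?_
    rw [LinearMap.mem_ker]
    by_cases hpn : n < p'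
    · haveI := W.subsingleton_obj hX (i := 2 * p') (by omega)
      rw [Subsingleton.elim x' 0, map_zero, LinearMap.zero_apply, map_zero]
    by_cases hqm : m < q'
    · haveI := W.subsingleton_obj hZ (i := 2 * q') (by omega)
      rw [Subsingleton.elim b' 0, map_zero, map_zero]
    have h : 2 * (n - p') + 2 * (m - q') = 2 * c := by omega
    have hh : 2 * (m - q') + 2 * q' = 2 * m := by omega
    rw [W.cupPairing_right_externalCup hX hZ h' hc (s := 2 * (c + q')) (by omega) (d' := 2 * (n - p'))
      (by omega) (by omega) (Or.inl ⟨p', two_mul _⟩) z x' b',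
      W.pushforward_fst_cup_snd_eq_rid_lTensor_kunnethComponent hX hZ h hh (s := 2 * (c + q')) (by omega)
      (d' := 2 * p') (by omega) (by omega) z b']
    exact ((W.mem_numTrivialClasses_iff_of_add_eq (show (n - p') + p' = n by omega) (by omega) _).mp
      (rid_lTensor_mem_of_mem_map₂ _ ⊤ _ (hz (n - p') (m - q') h))).2 x' hx'

/-- The Künneth component map carries `N^c(X × Z)` onto `N^p(X) ⊗ H^{2q}(Z)`.
[cite: Kahn2020, §6.4 Prop. 6.11 (6.4.1)–Prop. 6.12] [cite: Roman2008, Ch. 14 Th. 14.5–14.6] -/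
theorem map_kunnethComponent_numTrivialClasses_tensor (hX : IsSmoothProjective n X)
    (hZ : IsSmoothProjective m Z) (hZalg : ∀ q, W.algebraicClasses Z q = ⊤)
    (hZodd : ∀ j, Odd j → Module.finrank K (W.obj Z j) = 0) {p q c : ℕ} (h : 2 * p + 2 * q = 2 * c) :
    (W.algebraicClasses (X ⊗ Z) c ⊓ ⨅ (c' : ℕ), ⨅ (hc : 2 * c + 2 * c' = 2 * (n + m)),
        LinearMap.ker ((W.cupPairing (X ⊗ Z) (n + m) (2 * c) (2 * c') hc).domRestrict₂
          (W.algebraicClasses (X ⊗ Z) c'))).map (W.kunnethComponent hX hZ (2 * p) (2 * q) h) =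
      Submodule.map₂ (TensorProduct.mk K (W.obj X (2 * p)) (W.obj Z (2 * q)))
        (W.algebraicClasses X p ⊓ ⨅ (p' : ℕ), ⨅ (hp : 2 * p + 2 * p' = 2 * n),
          LinearMap.ker ((W.cupPairing X n (2 * p) (2 * p') hp).domRestrict₂ (W.algebraicClasses X p'))) ⊤ :=
  W.map_kunnethComponent_eq_of_mem_iff hX hZ (W.mem_numTrivialClasses_tensor_iff hX hZ hZalg hZodd) h

/-! ### §3 Dimensions and numerical ranks -/

/-- **`dim_K N^c(X × Z) = Σ_{p+q=c} dim_K N^p(X) · b_{2q}(Z)`** for `Z` with fully algebraic cohomology and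
`b_{odd}(Z) = 0`. [cite: Kahn2020, §6.4 Prop. 6.11 (6.4.1)–Prop. 6.12] [cite: Fulton1998, Ex. 1.10.2]
[cite: Roman2008, Ch. 14 Th. 14.6] -/
theorem finrank_numTrivialClasses_tensor (hX : IsSmoothProjective n X) (hZ : IsSmoothProjective m Z)
    (hZalg : ∀ q, W.algebraicClasses Z q = ⊤) (hZodd : ∀ j, Odd j → Module.finrank K (W.obj Z j) = 0)
    (c : ℕ) :
    Module.finrank K ↥(W.algebraicClasses (X ⊗ Z) c ⊓ ⨅ (c' : ℕ), ⨅ (hc : 2 * c + 2 * c' = 2 * (n + m)),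
        LinearMap.ker ((W.cupPairing (X ⊗ Z) (n + m) (2 * c) (2 * c') hc).domRestrict₂
          (W.algebraicClasses (X ⊗ Z) c'))) =
      ∑ pq ∈ antidiagonal c,
        Module.finrank K ↥(W.algebraicClasses X pq.1 ⊓ ⨅ (p' : ℕ), ⨅ (hp : 2 * pq.1 + 2 * p' = 2 * n),
            LinearMap.ker ((W.cupPairing X n (2 * pq.1) (2 * p') hp).domRestrict₂ (W.algebraicClasses X p'))) *
          Module.finrank K (W.obj Z (2 * pq.2)) := by
  refine W.finrank_eq_sum_of_kunneth_pieces hX hZ hZodd _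
    (fun p ↦ W.algebraicClasses X p ⊓ ⨅ (p' : ℕ), ⨅ (hp : 2 * p + 2 * p' = 2 * n),
      LinearMap.ker ((W.cupPairing X n (2 * p) (2 * p') hp).domRestrict₂ (W.algebraicClasses X p')))
    (fun z hz ↦ ?_) (fun p q h ↦ W.map_kunnethComponent_numTrivialClasses_tensor hX hZ hZalg hZodd h)
  refine (W.mem_numTrivialClasses_tensor_iff hX hZ hZalg hZodd z).mpr fun p q h ↦ ?_
  rw [← W.map_kunnethComponent_numTrivialClasses_tensor hX hZ hZalg hZodd h]
  exact hz _ _ h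

/-- **`ρ_c(X × Z) + Σ_{p+q=c} dim N^p(X)·b_{2q}(Z) = Σ_{p+q=c} dim K·Aᵖ(X)·b_{2q}(Z)`** (`c + c′ = n + m`):
the numerical rank of `X × Z` in codimension `c` — the rank of `K·Aᶜ(X × Z) × K·A^{c′}(X × Z) → K`, the
number in «order of the pole = rank» — from `ρ + dim N = dim K·A` on `X × Z`, §3 and row g53-#4's
`dim K·Aᶜ(X × Z) = Σ dim K·Aᵖ(X)·b_{2q}(Z)`; i.e. `ρ_c(X × Z) = Σ ρ_p(X)·b_{2q}(Z)`.
[cite: Kahn2020, §6.4 Prop. 6.11 (6.4.1)–Prop. 6.12] [cite: TateWoodsHole1965, §3 (12)] [cite: Kleiman1968AlgebraicCycles, §3] -/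
theorem finrank_range_cupPairing_tensor_add (hX : IsSmoothProjective n X) (hZ : IsSmoothProjective m Z)
    (hZalg : ∀ q, W.algebraicClasses Z q = ⊤) (hZodd : ∀ j, Odd j → Module.finrank K (W.obj Z j) = 0)
    {c c' : ℕ} (hcc' : c + c' = n + m) (h : 2 * c + 2 * c' = 2 * (n + m)) :
    Module.finrank K (LinearMap.range ((W.cupPairing (X ⊗ Z) (n + m) (2 * c) (2 * c') h).domRestrict₁₂
        (W.algebraicClasses (X ⊗ Z) c) (W.algebraicClasses (X ⊗ Z) c'))) +
      ∑ pq ∈ antidiagonal c,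
        Module.finrank K ↥(W.algebraicClasses X pq.1 ⊓ ⨅ (p' : ℕ), ⨅ (hp : 2 * pq.1 + 2 * p' = 2 * n),
            LinearMap.ker ((W.cupPairing X n (2 * pq.1) (2 * p') hp).domRestrict₂ (W.algebraicClasses X p'))) *
          Module.finrank K (W.obj Z (2 * pq.2)) =
      ∑ pq ∈ antidiagonal c,
        Module.finrank K (W.algebraicClasses X pq.1) * Module.finrank K (W.obj Z (2 * pq.2)) := by
  rw [← W.finrank_numTrivialClasses_tensor hX hZ hZalg hZodd c, ← W.finrank_algebraicClasses_tensor hX hZ hZalg hZodd c]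
  exact W.finrank_range_add_finrank_numTrivialClasses (IsSmoothProjective.tensor_holds hX hZ) hcc' h

/-- **`ρ_c(X × Z) = Σ_{p+q=c} (dim K·Aᵖ(X) − dim N^p(X))·b_{2q}(Z) = Σ_{p+q=c} ρ_p(X)·b_{2q}(Z)`**
(`c + c′ = n + m`; `ρ_p(X) = dim K·Aᵖ(X) − dim N^p(X)` by `finrank_range_cupPairing_eq_sub`).
[cite: Kahn2020, §6.4 Prop. 6.11 (6.4.1)–Prop. 6.12] [cite: TateWoodsHole1965, §3 (12)] [cite: Kleiman1968AlgebraicCycles, §3] -/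
theorem finrank_range_cupPairing_tensor (hX : IsSmoothProjective n X) (hZ : IsSmoothProjective m Z)
    (hZalg : ∀ q, W.algebraicClasses Z q = ⊤) (hZodd : ∀ j, Odd j → Module.finrank K (W.obj Z j) = 0)
    {c c' : ℕ} (hcc' : c + c' = n + m) (h : 2 * c + 2 * c' = 2 * (n + m)) :
    Module.finrank K (LinearMap.range ((W.cupPairing (X ⊗ Z) (n + m) (2 * c) (2 * c') h).domRestrict₁₂
        (W.algebraicClasses (X ⊗ Z) c) (W.algebraicClasses (X ⊗ Z) c'))) =
      ∑ pq ∈ antidiagonal c,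
        (Module.finrank K (W.algebraicClasses X pq.1) -
          Module.finrank K ↥(W.algebraicClasses X pq.1 ⊓ ⨅ (p' : ℕ), ⨅ (hp : 2 * pq.1 + 2 * p' = 2 * n),
            LinearMap.ker ((W.cupPairing X n (2 * pq.1) (2 * p') hp).domRestrict₂ (W.algebraicClasses X p')))) *
          Module.finrank K (W.obj Z (2 * pq.2)) := by
  rw [Nat.eq_sub_of_add_eq (W.finrank_range_cupPairing_tensor_add hX hZ hZalg hZodd hcc' h),
    ← Finset.sum_tsub_distrib _ (fun pq _ ↦ by
      haveI := W.finite_obj hX (2 * pq.1)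
      exact Nat.mul_le_mul_right _ (Submodule.finrank_mono inf_le_left))]
  exact Finset.sum_congr rfl fun pq _ ↦ (Nat.sub_mul _ _ _).symm

/-- **Under hom = num on `X`, `ρ_c(X × Z) = dim K·Aᶜ(X × Z) = Σ dim K·Aᵖ(X)·b_{2q}(Z)`**: if `N^p(X) = 0`
for every `p + q = c`, the pairing `K·Aᶜ(X × Z) × K·A^{c′}(X × Z) → K` has full rank.
[cite: Kleiman1968AlgebraicCycles, §3] [cite: Kahn2020, §6.4 Prop. 6.11–6.12 and §6.12.2] -/
theorem finrank_range_cupPairing_tensor_of_forall_eq_bot (hX : IsSmoothProjective n X)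
    (hZ : IsSmoothProjective m Z) (hZalg : ∀ q, W.algebraicClasses Z q = ⊤)
    (hZodd : ∀ j, Odd j → Module.finrank K (W.obj Z j) = 0) {c c' : ℕ} (hcc' : c + c' = n + m)
    (h : 2 * c + 2 * c' = 2 * (n + m))
    (hN : ∀ p q : ℕ, p + q = c →
      W.algebraicClasses X p ⊓ (⨅ (p' : ℕ), ⨅ (hp : 2 * p + 2 * p' = 2 * n),
        LinearMap.ker ((W.cupPairing X n (2 * p) (2 * p') hp).domRestrict₂ (W.algebraicClasses X p'))) = ⊥) :
    Module.finrank K (LinearMap.range ((W.cupPairing (X ⊗ Z) (n + m) (2 * c) (2 * c') h).domRestrict₁₂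
        (W.algebraicClasses (X ⊗ Z) c) (W.algebraicClasses (X ⊗ Z) c'))) =
      Module.finrank K (W.algebraicClasses (X ⊗ Z) c) := by
  rw [W.finrank_algebraicClasses_tensor hX hZ hZalg hZodd c,
    ← W.finrank_range_cupPairing_tensor_add hX hZ hZalg hZodd hcc' h, left_eq_add,
    Finset.sum_eq_zero_iff]
  intro pq hpq
  rw [hN pq.1 pq.2 (mem_antidiagonal.mp hpq), finrank_bot, zero_mul]

end WeilCohomology

end Literature.AlgebraicGeometry.Motives
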